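import Summits.HubbardSuperconductivity.HubbardSuperconductivity.Theses.NodalWardXY

/-!
# `GaugeCovariance` (item stmt-HubbardSuperconductivity-1270, route `NodalWardXY`)

The Ward/Peierls lemma behind "the pair phase `θ` enters only through gradients": on the
fermionic Fock space `ℓ²(Finset (Orb Λ))` of a finite orbital set `Orb Λ = Λ ×ₗ Fin 2`, the
diagonal unitary `U_θ(t) = diag_s exp(i t Σ_{o ∈ s} θ_{site o})` satisfies

* `U_θ(1) U_θ(-1) = 1`,
* `U_θ(1) c_{xσ} U_θ(-1) = e^{-iθ_x} c_{xσ}`,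
* `U_θ(1) c†_{xσ} U_θ(-1) = e^{+iθ_x} c†_{xσ}`.

This is Koma–Tasaki, PRL 68 (1992) 3248, eq. (8), with an imaginary angle (the tree's
`Literature.MathematicalPhysics.QuantumLattice.gaugeMatrix` is the real-exponent version, and the
unitary `phaseGauge (fun x => Circle.exp (θ x))` is the same matrix as `U_θ(1)` by
`phaseGauge_exp_eq_diagonal`); the statement is kept in the route's literal `diagonal` form and the proof
is the same entrywise computation: `(diag d · M · diag e)_{st} = d_s M_{st} e_t`, the annihilation
matrix `c_i` is supported on `t = insert i s` with `i ∉ s`, where `Σ_t θ = θ_x + Σ_s θ`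
(`Finset.sum_insert`), and the two phases combine by `Complex.exp_add`; the creation operator is the
conjugate transpose.
-/

-- `<Problem> = <Summit>` doubles the path component (project-wide `weak.linter.dupNamespace = false`
-- in the lakefile; repeated here so that single-file elaboration is warning-free too).
set_option linter.dupNamespace false

namespace Summit.HubbardSuperconductivity.HubbardSuperconductivity.Theorems

open Matrix Finset
open Literature.MathematicalPhysics.QuantumLattice

section GaugeCovariance

variable {ι : Type*} [LinearOrder ι]

/-- Entries of a two-sided diagonal conjugation: `(diag d · M · diag e)_{st} = d_s M_{st} e_t`. -/
theorem gaugeCov_diagonal_mul_mul_diagonal_apply [Fintype ι] (d e : Finset ι → ℂ)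
    (M : Matrix (Finset ι) (Finset ι) ℂ) (s t : Finset ι) :
    (diagonal d * M * diagonal e) s t = d s * M s t * e t := by
  rw [mul_diagonal, diagonal_mul]

omit [LinearOrder ι] in
/-- The phases `exp(± i Σ_{o∈s} φ o)` of the diagonal gauge rotation at `t = 1` and `t = -1` are
inverse to each other, for an orbital potential `φ : ι → ℝ`. -/
theorem gaugeCov_phase_mul_phase_neg (φ : ι → ℝ) (s : Finset ι) :
    Complex.exp (Complex.I * ((1 : ℝ) : ℂ) * ∑ o ∈ s, (φ o : ℂ)) *
        Complex.exp (Complex.I * ((-1 : ℝ) : ℂ) * ∑ o ∈ s, (φ o : ℂ)) = 1 := by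
  rw [← Complex.exp_add, ← Complex.exp_zero]
  congr 1
  push_cast
  ring

/-- Koma–Tasaki eq. (8) with imaginary angle, annihilation operator: conjugating `c_j` by the
diagonal phase rotation multiplies it by `e^{-iφ_j}`. -/
theorem gaugeCov_conj_annihilation [Fintype ι] (φ : ι → ℝ) (j : ι) :
    (diagonal fun s : Finset ι => Complex.exp (Complex.I * ((1 : ℝ) : ℂ) * ∑ o ∈ s, (φ o : ℂ))) *
        annihilation j *
        (diagonal fun s : Finset ι =>
          Complex.exp (Complex.I * ((-1 : ℝ) : ℂ) * ∑ o ∈ s, (φ o : ℂ))) =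
      Complex.exp (-(Complex.I * (φ j : ℂ))) • annihilation j := by
  ext s t
  rw [gaugeCov_diagonal_mul_mul_diagonal_apply, Matrix.smul_apply, smul_eq_mul]
  unfold annihilation
  split_ifs with h
  · rw [h.2, sum_insert h.1]
    have key : Complex.exp (Complex.I * ((1 : ℝ) : ℂ) * ∑ o ∈ s, (φ o : ℂ)) *
        Complex.exp (Complex.I * ((-1 : ℝ) : ℂ) * ((φ j : ℂ) + ∑ o ∈ s, (φ o : ℂ))) =
        Complex.exp (-(Complex.I * (φ j : ℂ))) := by
      rw [← Complex.exp_add]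
      congr 1
      push_cast
      ring
    linear_combination (jwSign j s) * key
  · simp

/-- Koma–Tasaki eq. (8) with imaginary angle, creation operator: conjugating `c†_j` by the
diagonal phase rotation multiplies it by `e^{+iφ_j}`. -/
theorem gaugeCov_conj_creation [Fintype ι] (φ : ι → ℝ) (j : ι) :
    (diagonal fun s : Finset ι => Complex.exp (Complex.I * ((1 : ℝ) : ℂ) * ∑ o ∈ s, (φ o : ℂ))) *
        creation j *
        (diagonal fun s : Finset ι =>
          Complex.exp (Complex.I * ((-1 : ℝ) : ℂ) * ∑ o ∈ s, (φ o : ℂ))) =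
      Complex.exp (Complex.I * (φ j : ℂ)) • creation j := by
  ext s t
  rw [gaugeCov_diagonal_mul_mul_diagonal_apply, Matrix.smul_apply, smul_eq_mul]
  unfold creation
  rw [conjTranspose_apply]
  unfold annihilation
  split_ifs with h
  · rw [h.2, sum_insert h.1]
    have key : Complex.exp (Complex.I * ((1 : ℝ) : ℂ) * ((φ j : ℂ) + ∑ o ∈ t, (φ o : ℂ))) *
        Complex.exp (Complex.I * ((-1 : ℝ) : ℂ) * ∑ o ∈ t, (φ o : ℂ)) =
        Complex.exp (Complex.I * (φ j : ℂ)) := by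
      rw [← Complex.exp_add]
      congr 1
      push_cast
      ring
    linear_combination (star (jwSign j t)) * key
  · simp

end GaugeCovariance

open Summit.HubbardSuperconductivity.HubbardSuperconductivity.Theses.NodalWardXY in
/-- **Item stmt-HubbardSuperconductivity-1270** (`NodalWardXY.GaugeCovariance`): for the unitary
`U_θ(t) = diag(e^{i t Σ_{o∈s} θ_{site(o)}})` on the Fock space of `Orb Λ`,
`U_θ(1) U_θ(-1) = 1`, `U_θ(1) c_{xσ} U_θ(-1) = e^{-iθ_x} c_{xσ}` and
`U_θ(1) c†_{xσ} U_θ(-1) = e^{iθ_x} c†_{xσ}` (Koma–Tasaki, PRL 68 (1992) 3248, eq. (8), with an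
imaginary angle; Peierls substitution). -/
theorem gaugeCovariance_proof : GaugeCovariance := by
  unfold GaugeCovariance
  intro Λ _ _ θ x σ
  dsimp only
  refine ⟨?_, ?_, ?_⟩
  · rw [diagonal_mul_diagonal, ← diagonal_one]
    congr 1
    funext s
    exact gaugeCov_phase_mul_phase_neg (fun o : Orb Λ => θ (ofLex o).1) s
  · exact gaugeCov_conj_annihilation (fun o : Orb Λ => θ (ofLex o).1) (orb x σ)
  · exact gaugeCov_conj_creation (fun o : Orb Λ => θ (ofLex o).1) (orb x σ)

end Summit.HubbardSuperconductivity.HubbardSuperconductivity.Theorems
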